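import Mathlib
import Summits.KontsevichZagierPeriods.Zeta5Search.DenomLaw.PathWeightBounds

/-!
# ζ(5) search — DENOM-LAW D1: `C⋆ ≤ a + 5` when the heaviest parameter has a single heavy partner

Cell `pub-zeta5`, track DENOM-LAW (denom-prover-d1 g7, 2026-08-24; ATTEMPT-8 §12).  HONEST FRAMING: systematic search; MODEL/structure side —
elementary counting on Hamiltonian paths of `K₇`; nothing about ζ(5); no γ; no irrationality claim; records in print UNMOVED.

## What is proved (kernel-checked)
`pathWeight_le_longCount_add_five` / `cStar_le_longCount_add_five`: if parameter `1` reaches `p` and the pair blocks `(1,2), …, (1,6)` lie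
below `p` (only `(1,7)` may reach `p`), then `C⋆ ≤ a + 5`: in a path the vertex `1` is either an end (then the interior heavy vertices are among
the other `a − 1`) or interior (its two path edges go to distinct vertices, at most one of them is `7`, so one edge is light).  With
`PathWeightBounds.pathAccounting_of_value_one` this turns RULE R1's value into the PATH node on every such type (`cStar_le_add_five_of_sorted`:
the b-form — sorted, `b₁ ≥ p`, pair block `(1,6)` below `p`).
-/

namespace Summit.KontsevichZagierPeriods.Zeta5Search.DenomLaw.FirstPeriodKit

open Finset
open Summit.KontsevichZagierPeriods.Zeta5Search.DenomLaw (Sorted7 BlockGe longCount pathWeight cStar)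

variable {b : ℕ → ℤ} {p : ℕ}

/-- **one heavy partner**: parameter `1` reaches `p`, the pair blocks `(1,k)`, `2 ≤ k ≤ 6`, lie below `p` ⇒ every path weighs `≤ a + 5`. -/
theorem pathWeight_le_longCount_add_five (h0 : (p : ℤ) ≤ b 1)
    (hlow : ∀ k : Fin 7, k.val ≠ 0 → k.val ≠ 6 → b 0 - b 1 - b (k.val + 1) < (p : ℤ)) (π : Equiv.Perm (Fin 7)) :
    pathWeight b p π ≤ longCount b p + 5 := by
  unfold pathWeight longCount
  set s : Fin 7 := π.symm 0 with hs
  have hπs : π s = 0 := by rw [hs]; simp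
  have key : ∀ j : Fin 7, (π j).val = 0 → j = s := by
    intro j h
    have h' : π j = π s := by rw [hπs]; exact Fin.ext h
    exact π.injective h'
  set H := (Finset.range 7).filter fun i => (p : ℤ) ≤ b (i + 1) with hH
  set S1 := (Finset.univ : Finset (Fin 5)).filter fun t => (p : ℤ) ≤ b ((π ⟨t.val + 1, by omega⟩).val + 1) with hS1
  set S2 := (Finset.univ : Finset (Fin 6)).filter fun t =>
      (p : ℤ) ≤ b 0 - b ((π ⟨t.val, by omega⟩).val + 1) - b ((π ⟨t.val + 1, by omega⟩).val + 1) with hS2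
  have h0H : 0 ∈ H := by rw [hH, Finset.mem_filter, Finset.mem_range]; exact ⟨by norm_num, h0⟩
  have cS2 : S2.card ≤ 6 := le_trans (Finset.card_filter_le _ _) (by simp)
  -- a heavy edge touching the vertex `1` goes to the vertex `7`
  have edge : ∀ t ∈ S2, ((π ⟨t.val, by omega⟩).val = 0 → (π ⟨t.val + 1, by omega⟩).val = 6) ∧
      ((π ⟨t.val + 1, by omega⟩).val = 0 → (π ⟨t.val, by omega⟩).val = 6) := by
    intro t ht
    rw [hS2, Finset.mem_filter] at ht
    obtain ⟨-, hge⟩ := ht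
    have hne : (⟨t.val, by omega⟩ : Fin 7) ≠ ⟨t.val + 1, by omega⟩ := by
      intro h; have := congrArg Fin.val h; simp at this
    constructor
    · intro hv
      by_contra h6
      have hk : (π ⟨t.val + 1, by omega⟩).val ≠ 0 := by
        intro h0'
        exact hne ((key _ hv).trans (key _ h0').symm)
      have := hlow _ hk h6
      rw [hv] at hge
      linarith
    · intro hv
      by_contra h6
      have hk : (π ⟨t.val, by omega⟩).val ≠ 0 := by
        intro h0'
        exact hne ((key _ h0').trans (key _ hv).symm)
      have := hlow _ hk h6
      rw [hv] at hge
      linarith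
  by_cases hint : 1 ≤ s.val ∧ s.val ≤ 5
  · -- interior: the generic vertex bound, and one of the two edges at `1` is light
    have c1 : S1.card ≤ H.card := by
      refine Finset.card_le_card_of_injOn (fun t : Fin 5 => (π ⟨t.val + 1, by omega⟩).val) ?_ ?_
      · intro t ht
        simp only [hS1, Finset.coe_filter, Finset.mem_univ, true_and, Set.mem_setOf_eq] at ht
        simp only [hH, Finset.coe_filter, Finset.mem_range, Set.mem_setOf_eq]
        exact ⟨(π ⟨t.val + 1, by omega⟩).isLt, ht⟩
      · intro t _ t' _ h
        have h' : π ⟨t.val + 1, by omega⟩ = π ⟨t'.val + 1, by omega⟩ := Fin.ext h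
        have h'' := π.injective h'
        simp only [Fin.mk.injEq] at h''
        exact Fin.ext (by omega)
    set t₁ : Fin 6 := ⟨s.val - 1, by omega⟩ with ht₁
    set t₂ : Fin 6 := ⟨s.val, by omega⟩ with ht₂
    have z₁ : (π ⟨t₁.val + 1, by omega⟩).val = 0 := by
      rw [show (⟨t₁.val + 1, by omega⟩ : Fin 7) = s from Fin.ext (by show s.val - 1 + 1 = s.val; omega), hπs]; rfl
    have z₂ : (π ⟨t₂.val, by omega⟩).val = 0 := by
      rw [show (⟨t₂.val, by omega⟩ : Fin 7) = s from Fin.ext rfl, hπs]; rfl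
    have notboth : ¬ (t₁ ∈ S2 ∧ t₂ ∈ S2) := by
      rintro ⟨m₁, m₂⟩
      have e₁ := (edge t₁ m₁).2 z₁
      have e₂ := (edge t₂ m₂).1 z₂
      have : (⟨t₁.val, by omega⟩ : Fin 7) = ⟨t₂.val + 1, by omega⟩ :=
        π.injective (Fin.ext (by rw [e₁, e₂]))
      have := congrArg Fin.val this
      change s.val - 1 = s.val + 1 at this
      omega
    have c2 : S2.card ≤ 5 := by
      by_cases m₂ : t₂ ∈ S2
      · have m₁ : t₁ ∉ S2 := fun m₁ => notboth ⟨m₁, m₂⟩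
        have sub : S2 ⊆ (Finset.univ : Finset (Fin 6)).erase t₁ :=
          fun t ht => Finset.mem_erase.2 ⟨fun h => m₁ (h ▸ ht), Finset.mem_univ _⟩
        have := Finset.card_le_card sub
        rw [Finset.card_erase_of_mem (Finset.mem_univ _), Finset.card_univ, Fintype.card_fin] at this
        exact this
      · have sub : S2 ⊆ (Finset.univ : Finset (Fin 6)).erase t₂ :=
          fun t ht => Finset.mem_erase.2 ⟨fun h => m₂ (h ▸ ht), Finset.mem_univ _⟩
        have := Finset.card_le_card sub
        rw [Finset.card_erase_of_mem (Finset.mem_univ _), Finset.card_univ, Fintype.card_fin] at this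
        exact this
    omega
  · -- endpoint: no interior vertex is `1`
    have c1 : S1.card ≤ (H.erase 0).card := by
      refine Finset.card_le_card_of_injOn (fun t : Fin 5 => (π ⟨t.val + 1, by omega⟩).val) ?_ ?_
      · intro t ht
        simp only [hS1, Finset.coe_filter, Finset.mem_univ, true_and, Set.mem_setOf_eq] at ht
        simp only [hH, Finset.coe_erase, Finset.coe_filter, Finset.mem_range, Set.mem_sdiff, Set.mem_setOf_eq,
          Set.mem_singleton_iff]
        refine ⟨⟨(π ⟨t.val + 1, by omega⟩).isLt, ht⟩, fun h0' => ?_⟩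
        have := congrArg Fin.val (key _ h0')
        simp at this
        omega
      · intro t _ t' _ h
        have h' : π ⟨t.val + 1, by omega⟩ = π ⟨t'.val + 1, by omega⟩ := Fin.ext h
        have h'' := π.injective h'
        simp only [Fin.mk.injEq] at h''
        exact Fin.ext (by omega)
    have hc : (H.erase 0).card + 1 = H.card := Finset.card_erase_add_one h0H
    omega

/-- **`C⋆ ≤ a + 5` with one heavy partner.** -/
theorem cStar_le_longCount_add_five (h0 : (p : ℤ) ≤ b 1)
    (hlow : ∀ k : Fin 7, k.val ≠ 0 → k.val ≠ 6 → b 0 - b 1 - b (k.val + 1) < (p : ℤ)) : cStar b p ≤ longCount b p + 5 :=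
  Finset.sup_le fun π _ => pathWeight_le_longCount_add_five h0 hlow π

/-- the b-form: sorted, `b₁ ≥ p`, pair block `(1,6)` below `p` ⇒ `C⋆ ≤ a + 5`. -/
theorem cStar_le_add_five_of_sorted (hs : Sorted7 b) (h1 : (p : ℤ) ≤ b 1) (h16 : ¬ BlockGe b p 1 6) :
    cStar b p ≤ longCount b p + 5 := by
  obtain ⟨s2, s3, s4, s5, s6, s7⟩ := sorted7_chain hs
  have h16' := not_le.1 h16
  refine cStar_le_longCount_add_five h1 fun k hk hk6 => ?_
  fin_cases k <;> simp at hk hk6 ⊢ <;> linarith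

end Summit.KontsevichZagierPeriods.Zeta5Search.DenomLaw.FirstPeriodKit
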